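import Summits.QuantumFields.YangMills.Theorems.FluctuationComparisonRegPrIntLWregGlue
import Literature.MathematicalPhysics.QuantumFieldTheory.Balaban1983to89.B12ContinuousTransportInvariance
import HarnessLib

/-!
# S2β · LINE g18-1 · DET-REP-B‴∘ ∕ JACW — (J-PIN) brick 3: FROM THE A.E. IDENTIFICATION TO THE POINT — a window chart's Jacobian at a live good point
# equals the reference density there (regularity in the datum for a.e. fine field, then continuity in the fine field; Haar charges open sets)

Cell `ym3-torus` (rung R3: continuum `SU(2)` Yang–Mills on `T³` — NOT `d = 4`, NOT infinite volume, NOT a mass gap, NOT Clay); width seat `ym-ust-20520-w5` g16;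
helper of the crux `stmt-QuantumFields-20520` (`--supports … --as helper`, NOT a proof of it).  Road (R1) of FINDING #41 §3; sequel of ✓brick 2
`…S2BetaChartJacPinningAE.windowChart_jac_ae_eq` (`c.jac =ᵐ[μ_J⌊O ⊗ ν_K] G′`).

THE POINT.  The JACW-ROW reads `c.jac` AT the charted minimisers `(V₀, U*)` — points, not a.e. classes.  Brick 2 pins `c.jac` to a reference density `G′` almost
everywhere for `μ_J⌊O ⊗ ν_K`; this file upgrades «a.e.» to «at `(V₀, U)`» for every LIVE GOOD point (`U ∈ S ∩ fibre V₀`) from: the window chart's `regular` field (for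
every `V₀ ∈ O` and ν-a.e. `z`: continuity of `jac (·, z)` at `V₀` on the live good leaves — the other branch is excluded there), its `ChartRows` clauses in tree letters
(carrier `{jac (V₀,·) ≠ 0} ∈ 𝓝 U`, relative openness of `{Φ (V₀,·) ∈ S}` in it, `ContinuousOn (jac (V₀,·))` on it), openness of `O` and `S`, the corresponding two
continuity rows of `G′` (hypotheses — for the explicit product chart they are ✓IV-c's conjuncts (7)/(8)/(16)/(20) + the EDGE∕LEVEL null rows of the lineage), Fubini for
null sets (`Measure.ae_ae_comm`) and «product Haar charges open sets» (lit ✓`isOpenPosMeasure_fieldMeasure_SU`).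
* §1 ★`eq_of_ae_eq_on_open_of_continuousAt` — generic: `f = g` a.e. on an open `O ∋ x₀` for a measure positive on open sets, both continuous at `x₀`, values in a
  Hausdorff space ⟹ `f x₀ = g x₀`.
* §2 ★★★`windowChart_jac_eq_at` — the window-chart statement above: `(c.jac (V₀, U) : ℝ≥0∞) = G′ (V₀, U)`.
* §3 (v1.1) ★★★`windowChart_jac_eq_at_local` — the same with the `G′ (·, z)`-continuity asked only for a.e. `z` in a neighbourhood of `U` (the docking shape).
With ✓p761834 (`Jac = 1·Π_c jd`), ✓`fibredLaw_transport`, ✓p762333, ✓brick 2 and this file, the JACW hand reads `log c.jac` at the four corners as `Σ_{c′} log jd c′ …`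
(✓p761834 `log_jac_apply_eq_sum_log_of_mem`) and owes only the four one-edge rows per coarse bond of ✓p761050.
HONEST SCOPE.  Point-set ∕ measure bookkeeping; def-free; default heartbeats; proves nothing of BRD, DETN∕JACW's value bound, DET-REP-B‴∘, S2β or the crux 20520;
`YM3TorusSU2` NOT proved; the Yang–Mills mass gap (Clay) NOT proved.
[cite: Balaban1987RG1, (0.4) p.253 and (2.10) p.267] [cite: Bogachev2007, Thm 2.5.3]
-/

set_option autoImplicit false

noncomputable section

open MeasureTheory Filter Topology Set Function
open scoped ENNReal NNReal
open Literature.MathematicalPhysics.QuantumFieldTheory.Balaban1983to89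
open Literature.MathematicalPhysics.QuantumFieldTheory.Balaban1983to89.T3ContinuumYM3Torus
open Literature.MathematicalPhysics.QuantumFieldTheory.Balaban1983to89.T3NestedUnitLaws
open Literature.MathematicalPhysics.QuantumFieldTheory.Balaban1983to89.T3UnitLawDensityEML
open Literature.MathematicalPhysics.QuantumFieldTheory.Balaban1983to89.T3UnitScaleTilt
open Literature.MathematicalPhysics.QuantumFieldTheory.Balaban1983to89.T3TiltDescent
open Literature.MathematicalPhysics.QuantumFieldTheory.Balaban1983to89.T3LevelShift
open Literature.MathematicalPhysics.QuantumFieldTheory.Balaban1983to89.T4Continuum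
open scoped Literature.MathematicalPhysics.QuantumFieldTheory.Balaban1983to89.T3OrbitAverage

namespace Summit.QuantumFields.YangMills.Theorems.FluctuationComparisonRegPrIntLS2BetaChartJacPinningPoint

open Literature.MathematicalPhysics.QuantumFieldTheory.Balaban1983to89.B12ContinuousTransportInvariance (isOpenPosMeasure_fieldMeasure_SU)

/-! ## §1 From «a.e. on an open set» to «at a point of continuity» -/

section Generic

variable {Y E : Type*} [TopologicalSpace Y] [MeasurableSpace Y] [TopologicalSpace E] [T2Space E]

/-- ★ **A.E.-EQUAL ON AN OPEN SET + CONTINUOUS AT A POINT OF IT ⟹ EQUAL THERE** (measure positive on non-empty open sets, Hausdorff values).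
[cite: Bogachev2007, Thm 2.5.3] -/
theorem eq_of_ae_eq_on_open_of_continuousAt {μ : Measure Y} [μ.IsOpenPosMeasure] {O : Set Y} (hO : IsOpen O) {x₀ : Y} (hx₀ : x₀ ∈ O)
    {f g : Y → E} (h : ∀ᵐ y ∂μ, y ∈ O → f y = g y) (hf : ContinuousAt f x₀) (hg : ContinuousAt g x₀) : f x₀ = g x₀ := by
  have hdense : Dense {y | y ∈ O → f y = g y} := Measure.dense_of_ae h
  have hclos : x₀ ∈ closure (O ∩ {y | y ∈ O → f y = g y}) := hdense.open_subset_closure_inter hO hx₀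
  haveI : (𝓝[O ∩ {y | y ∈ O → f y = g y}] x₀).NeBot := mem_closure_iff_nhdsWithin_neBot.1 hclos
  have ht : Tendsto (fun y => (f y, g y)) (𝓝[O ∩ {y | y ∈ O → f y = g y}] x₀) (𝓝 (f x₀, g x₀)) :=
    ((hf.prodMk hg).tendsto).mono_left nhdsWithin_le_nhds
  have hev : ∀ᶠ y in 𝓝[O ∩ {y | y ∈ O → f y = g y}] x₀, (f y, g y) ∈ diagonal E :=
    eventually_mem_nhdsWithin.mono fun y hy => hy.2 hy.1
  exact isClosed_diagonal.mem_of_tendsto ht hev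

end Generic

/-! ## §2 The window chart at a live good point -/

section Window

variable (F : T3Family) {J K : ℕ} (hJK : J ≤ K)

/-- ★★★ **A WINDOW CHART'S JACOBIAN AT A LIVE GOOD POINT EQUALS THE REFERENCE DENSITY THERE.**  Let `c : WindowChart F hJK S O` with `O` open, and a
measurable reference density `G′` with `c.jac = G′` a.e. for `μ_J⌊O ⊗ ν_K` (✓brick 2).  At a datum `V₀ ∈ O` and a fine field `U ∈ S` over it (`descendTo U = V₀`)
assume `c`'s `ChartRows` clauses at `V₀` in tree letters — the live carrier `{z | c.jac (V₀,z) ≠ 0}` is a neighbourhood of `U`, `{z | c.Φ (V₀,z) ∈ S}` is relatively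
open in it, `c.jac (V₀,·)` is continuous on it, `c.Φ (V₀, U) = U` — and two continuity rows of `G′`: `G′ (·, z)` continuous at `V₀` for ν-a.e. `z`, and `G′ (V₀, ·)`
continuous at `U`.  Then `(c.jac (V₀, U) : ℝ≥0∞) = G′ (V₀, U)`.  (The `regular` field of `c` supplies the continuity of `c.jac (·, z)` at `V₀` on a.e. live good leaf;
Fubini for null sets turns the product-a.e. identity into «for a.e. `z`, a.e. in `V`»; Haar charges open sets twice.) [cite: Balaban1987RG1, (2.10) p.267] [cite: Bogachev2007, Thm 2.5.3] -/
theorem windowChart_jac_eq_at {S : Set (GaugeField (F.P K) 0 (Matrix.specialUnitaryGroup (Fin 2) ℂ))}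
    {O : Set (GaugeField (F.P J) 0 (Matrix.specialUnitaryGroup (Fin 2) ℂ))} (hOo : IsOpen O)
    (c : Summit.QuantumFields.YangMills.Theorems.FluctuationComparisonRegPrIntLWregGlue.WindowChart F hJK S O)
    {G' : GaugeField (F.P J) 0 (Matrix.specialUnitaryGroup (Fin 2) ℂ) × GaugeField (F.P K) 0 (Matrix.specialUnitaryGroup (Fin 2) ℂ) → ℝ≥0∞}
    (hG' : Measurable G')
    (hae : (fun p => (c.jac p : ℝ≥0∞)) =ᵐ[((fieldMeasure (F.P J) 0 (Matrix.specialUnitaryGroup (Fin 2) ℂ)).restrict O).prod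
        (fieldMeasure (F.P K) 0 (Matrix.specialUnitaryGroup (Fin 2) ℂ))] G')
    {V₀ : GaugeField (F.P J) 0 (Matrix.specialUnitaryGroup (Fin 2) ℂ)} (hV₀ : V₀ ∈ O)
    {U : GaugeField (F.P K) 0 (Matrix.specialUnitaryGroup (Fin 2) ℂ)} (hUS : U ∈ S)
    (hcarr : {z | c.jac (V₀, z) ≠ 0} ∈ 𝓝 U) (hΦU : c.Φ (V₀, U) = U)
    (hrel : IsOpen ((Subtype.val : {z | c.jac (V₀, z) ≠ 0} → GaugeField (F.P K) 0 (Matrix.specialUnitaryGroup (Fin 2) ℂ)) ⁻¹' {z | c.Φ (V₀, z) ∈ S}))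
    (hcz : ContinuousOn (fun z => (c.jac (V₀, z) : ℝ)) {z | c.jac (V₀, z) ≠ 0})
    (hGV : ∀ᵐ z ∂fieldMeasure (F.P K) 0 (Matrix.specialUnitaryGroup (Fin 2) ℂ), ContinuousAt (fun V => G' (V, z)) V₀)
    (hGz : ContinuousAt (fun z => G' (V₀, z)) U) :
    (c.jac (V₀, U) : ℝ≥0∞) = G' (V₀, U) := by
  haveI : (fieldMeasure (F.P J) 0 (Matrix.specialUnitaryGroup (Fin 2) ℂ)).IsOpenPosMeasure := isOpenPosMeasure_fieldMeasure_SU 2 (F.P J) 0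
  haveI : (fieldMeasure (F.P K) 0 (Matrix.specialUnitaryGroup (Fin 2) ℂ)).IsOpenPosMeasure := isOpenPosMeasure_fieldMeasure_SU 2 (F.P K) 0
  -- (1) Fubini for null sets: for ν-a.e. `z`, `jac (·, z) = G′ (·, z)` a.e. on `O`
  have hmeas : MeasurableSet {p : GaugeField (F.P J) 0 (Matrix.specialUnitaryGroup (Fin 2) ℂ) ×
      GaugeField (F.P K) 0 (Matrix.specialUnitaryGroup (Fin 2) ℂ) | (c.jac (p.1, p.2) : ℝ≥0∞) = G' (p.1, p.2)} :=
    measurableSet_eq_fun c.measurable_jac.coe_nnreal_ennreal hG'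
  have hVz : ∀ᵐ V ∂(fieldMeasure (F.P J) 0 (Matrix.specialUnitaryGroup (Fin 2) ℂ)).restrict O,
      ∀ᵐ z ∂fieldMeasure (F.P K) 0 (Matrix.specialUnitaryGroup (Fin 2) ℂ), (c.jac (V, z) : ℝ≥0∞) = G' (V, z) :=
    (Measure.ae_prod_iff_ae_ae hmeas).1 hae
  have hzV : ∀ᵐ z ∂fieldMeasure (F.P K) 0 (Matrix.specialUnitaryGroup (Fin 2) ℂ),
      ∀ᵐ V ∂(fieldMeasure (F.P J) 0 (Matrix.specialUnitaryGroup (Fin 2) ℂ)).restrict O, (c.jac (V, z) : ℝ≥0∞) = G' (V, z) :=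
    (Measure.ae_ae_comm (μ := (fieldMeasure (F.P J) 0 (Matrix.specialUnitaryGroup (Fin 2) ℂ)).restrict O)
      (ν := fieldMeasure (F.P K) 0 (Matrix.specialUnitaryGroup (Fin 2) ℂ))
      (p := fun V z => (c.jac (V, z) : ℝ≥0∞) = G' (V, z)) hmeas).1 hVz
  -- (2) the live good leaves at `V₀` form a neighbourhood of `U`
  obtain ⟨Gop, hGop, hGeq⟩ := hrel
  have hUG : U ∈ Gop := by
    have hUcarr : U ∈ {z | c.jac (V₀, z) ≠ 0} := mem_of_mem_nhds hcarr
    have h1 : (⟨U, hUcarr⟩ : {z | c.jac (V₀, z) ≠ 0}) ∈ (Subtype.val ⁻¹' {z | c.Φ (V₀, z) ∈ S}) := by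
      show c.Φ (V₀, U) ∈ S
      rw [hΦU]; exact hUS
    rw [← hGeq] at h1
    exact h1
  have hL : {z | c.jac (V₀, z) ≠ 0 ∧ c.Φ (V₀, z) ∈ S} ∈ 𝓝 U := by
    filter_upwards [hcarr, hGop.mem_nhds hUG] with z hz hzG
    have h1 : (⟨z, hz⟩ : {z | c.jac (V₀, z) ≠ 0}) ∈ Subtype.val ⁻¹' Gop := hzG
    rw [hGeq] at h1
    exact ⟨hz, h1⟩
  -- (3) on a.e. live good leaf, `jac (·, z)` is continuous at `V₀` (the `regular` field, first branch), hence equals `G′ (·, z)` at `V₀`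
  have hreg := c.regular V₀ hV₀
  have hpt : ∀ᵐ z ∂fieldMeasure (F.P K) 0 (Matrix.specialUnitaryGroup (Fin 2) ℂ),
      z ∈ {z | c.jac (V₀, z) ≠ 0 ∧ c.Φ (V₀, z) ∈ S} → (c.jac (V₀, z) : ℝ≥0∞) = G' (V₀, z) := by
    filter_upwards [hreg, hzV, hGV] with z hz hzV' hGV' hzL
    rcases hz with ⟨hcont, -, -⟩ | hdead
    · have hcont' : ContinuousAt (fun V => (c.jac (V, z) : ℝ≥0∞)) V₀ :=
        ENNReal.continuous_coe.continuousAt.comp (continuous_real_toNNReal.continuousAt.comp hcont |>.congr (Eventually.of_forall fun V => by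
          simp only [Function.comp, Real.toNNReal_coe]))
      have hO' : ∀ᵐ V ∂fieldMeasure (F.P J) 0 (Matrix.specialUnitaryGroup (Fin 2) ℂ), V ∈ O → (c.jac (V, z) : ℝ≥0∞) = G' (V, z) :=
        (ae_restrict_iff' hOo.measurableSet).1 hzV'
      exact eq_of_ae_eq_on_open_of_continuousAt hOo hV₀ hO' hcont' hGV'
    · exfalso
      rcases hdead.self_of_nhds with h0 | hS
      · exact hzL.1 h0
      · exact hS hzL.2
  -- (4) continuity in `z` at `U` on both sides, and Haar charges open sets again
  obtain ⟨W, hWL, hWo, hUW⟩ := mem_nhds_iff.1 hL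
  have hcU : ContinuousAt (fun z => (c.jac (V₀, z) : ℝ≥0∞)) U := by
    have h1 : ContinuousAt (fun z => (c.jac (V₀, z) : ℝ)) U := hcz.continuousAt hcarr
    exact ENNReal.continuous_coe.continuousAt.comp (continuous_real_toNNReal.continuousAt.comp h1 |>.congr (Eventually.of_forall fun z => by
      simp only [Function.comp, Real.toNNReal_coe]))
  have hW' : ∀ᵐ z ∂fieldMeasure (F.P K) 0 (Matrix.specialUnitaryGroup (Fin 2) ℂ), z ∈ W → (c.jac (V₀, z) : ℝ≥0∞) = G' (V₀, z) :=
    hpt.mono fun z hz hzW => hz (hWL hzW)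
  exact eq_of_ae_eq_on_open_of_continuousAt hWo hUW hW' hcU hGz

/-! ## §3 (v1.1 APPEND) The localised edition: the reference density need only be regular in the datum on a.e. leaf NEAR the point -/

/-- ★★★ **THE LOCALISED EDITION OF `windowChart_jac_eq_at`** (the honest docking shape): the continuity of `G′ (·, z)` at `V₀` is asked only for ν-a.e. `z` in
SOME neighbourhood `N` of `U` (for the explicit product chart: the all-interior leaves near `U`, a.e. by the EDGE null row; for a second window chart `ĉ`: its
`regular` field on its own live good leaves).  Same proof, with the leaf-neighbourhood intersected with `N`. [cite: Balaban1987RG1, (2.10) p.267] [cite: Bogachev2007, Thm 2.5.3] -/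
theorem windowChart_jac_eq_at_local {S : Set (GaugeField (F.P K) 0 (Matrix.specialUnitaryGroup (Fin 2) ℂ))}
    {O : Set (GaugeField (F.P J) 0 (Matrix.specialUnitaryGroup (Fin 2) ℂ))} (hOo : IsOpen O)
    (c : Summit.QuantumFields.YangMills.Theorems.FluctuationComparisonRegPrIntLWregGlue.WindowChart F hJK S O)
    {G' : GaugeField (F.P J) 0 (Matrix.specialUnitaryGroup (Fin 2) ℂ) × GaugeField (F.P K) 0 (Matrix.specialUnitaryGroup (Fin 2) ℂ) → ℝ≥0∞}
    (hG' : Measurable G')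
    (hae : (fun p => (c.jac p : ℝ≥0∞)) =ᵐ[((fieldMeasure (F.P J) 0 (Matrix.specialUnitaryGroup (Fin 2) ℂ)).restrict O).prod
        (fieldMeasure (F.P K) 0 (Matrix.specialUnitaryGroup (Fin 2) ℂ))] G')
    {V₀ : GaugeField (F.P J) 0 (Matrix.specialUnitaryGroup (Fin 2) ℂ)} (hV₀ : V₀ ∈ O)
    {U : GaugeField (F.P K) 0 (Matrix.specialUnitaryGroup (Fin 2) ℂ)} (hUS : U ∈ S)
    (hcarr : {z | c.jac (V₀, z) ≠ 0} ∈ 𝓝 U) (hΦU : c.Φ (V₀, U) = U)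
    (hrel : IsOpen ((Subtype.val : {z | c.jac (V₀, z) ≠ 0} → GaugeField (F.P K) 0 (Matrix.specialUnitaryGroup (Fin 2) ℂ)) ⁻¹' {z | c.Φ (V₀, z) ∈ S}))
    (hcz : ContinuousOn (fun z => (c.jac (V₀, z) : ℝ)) {z | c.jac (V₀, z) ≠ 0})
    {N : Set (GaugeField (F.P K) 0 (Matrix.specialUnitaryGroup (Fin 2) ℂ))} (hN : N ∈ 𝓝 U)
    (hGV : ∀ᵐ z ∂fieldMeasure (F.P K) 0 (Matrix.specialUnitaryGroup (Fin 2) ℂ), z ∈ N → ContinuousAt (fun V => G' (V, z)) V₀)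
    (hGz : ContinuousAt (fun z => G' (V₀, z)) U) :
    (c.jac (V₀, U) : ℝ≥0∞) = G' (V₀, U) := by
  haveI : (fieldMeasure (F.P J) 0 (Matrix.specialUnitaryGroup (Fin 2) ℂ)).IsOpenPosMeasure := isOpenPosMeasure_fieldMeasure_SU 2 (F.P J) 0
  haveI : (fieldMeasure (F.P K) 0 (Matrix.specialUnitaryGroup (Fin 2) ℂ)).IsOpenPosMeasure := isOpenPosMeasure_fieldMeasure_SU 2 (F.P K) 0
  have hmeas : MeasurableSet {p : GaugeField (F.P J) 0 (Matrix.specialUnitaryGroup (Fin 2) ℂ) ×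
      GaugeField (F.P K) 0 (Matrix.specialUnitaryGroup (Fin 2) ℂ) | (c.jac (p.1, p.2) : ℝ≥0∞) = G' (p.1, p.2)} :=
    measurableSet_eq_fun c.measurable_jac.coe_nnreal_ennreal hG'
  have hVz : ∀ᵐ V ∂(fieldMeasure (F.P J) 0 (Matrix.specialUnitaryGroup (Fin 2) ℂ)).restrict O,
      ∀ᵐ z ∂fieldMeasure (F.P K) 0 (Matrix.specialUnitaryGroup (Fin 2) ℂ), (c.jac (V, z) : ℝ≥0∞) = G' (V, z) :=
    (Measure.ae_prod_iff_ae_ae hmeas).1 hae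
  have hzV : ∀ᵐ z ∂fieldMeasure (F.P K) 0 (Matrix.specialUnitaryGroup (Fin 2) ℂ),
      ∀ᵐ V ∂(fieldMeasure (F.P J) 0 (Matrix.specialUnitaryGroup (Fin 2) ℂ)).restrict O, (c.jac (V, z) : ℝ≥0∞) = G' (V, z) :=
    (Measure.ae_ae_comm (μ := (fieldMeasure (F.P J) 0 (Matrix.specialUnitaryGroup (Fin 2) ℂ)).restrict O)
      (ν := fieldMeasure (F.P K) 0 (Matrix.specialUnitaryGroup (Fin 2) ℂ))
      (p := fun V z => (c.jac (V, z) : ℝ≥0∞) = G' (V, z)) hmeas).1 hVz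
  obtain ⟨Gop, hGop, hGeq⟩ := hrel
  have hUG : U ∈ Gop := by
    have hUcarr : U ∈ {z | c.jac (V₀, z) ≠ 0} := mem_of_mem_nhds hcarr
    have h1 : (⟨U, hUcarr⟩ : {z | c.jac (V₀, z) ≠ 0}) ∈ (Subtype.val ⁻¹' {z | c.Φ (V₀, z) ∈ S}) := by
      show c.Φ (V₀, U) ∈ S
      rw [hΦU]; exact hUS
    rw [← hGeq] at h1
    exact h1
  have hL : ({z | c.jac (V₀, z) ≠ 0 ∧ c.Φ (V₀, z) ∈ S} ∩ N) ∈ 𝓝 U := by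
    refine inter_mem ?_ hN
    filter_upwards [hcarr, hGop.mem_nhds hUG] with z hz hzG
    have h1 : (⟨z, hz⟩ : {z | c.jac (V₀, z) ≠ 0}) ∈ Subtype.val ⁻¹' Gop := hzG
    rw [hGeq] at h1
    exact ⟨hz, h1⟩
  have hreg := c.regular V₀ hV₀
  have hpt : ∀ᵐ z ∂fieldMeasure (F.P K) 0 (Matrix.specialUnitaryGroup (Fin 2) ℂ),
      z ∈ ({z | c.jac (V₀, z) ≠ 0 ∧ c.Φ (V₀, z) ∈ S} ∩ N) → (c.jac (V₀, z) : ℝ≥0∞) = G' (V₀, z) := by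
    filter_upwards [hreg, hzV, hGV] with z hz hzV' hGV' hzL
    rcases hz with ⟨hcont, -, -⟩ | hdead
    · have hcont' : ContinuousAt (fun V => (c.jac (V, z) : ℝ≥0∞)) V₀ :=
        ENNReal.continuous_coe.continuousAt.comp (continuous_real_toNNReal.continuousAt.comp hcont |>.congr (Eventually.of_forall fun V => by
          simp only [Function.comp, Real.toNNReal_coe]))
      have hO' : ∀ᵐ V ∂fieldMeasure (F.P J) 0 (Matrix.specialUnitaryGroup (Fin 2) ℂ), V ∈ O → (c.jac (V, z) : ℝ≥0∞) = G' (V, z) :=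
        (ae_restrict_iff' hOo.measurableSet).1 hzV'
      exact eq_of_ae_eq_on_open_of_continuousAt hOo hV₀ hO' hcont' (hGV' hzL.2)
    · exfalso
      rcases hdead.self_of_nhds with h0 | hS
      · exact hzL.1.1 h0
      · exact hS hzL.1.2
  obtain ⟨W, hWL, hWo, hUW⟩ := mem_nhds_iff.1 hL
  have hcU : ContinuousAt (fun z => (c.jac (V₀, z) : ℝ≥0∞)) U := by
    have h1 : ContinuousAt (fun z => (c.jac (V₀, z) : ℝ)) U := hcz.continuousAt hcarr
    exact ENNReal.continuous_coe.continuousAt.comp (continuous_real_toNNReal.continuousAt.comp h1 |>.congr (Eventually.of_forall fun z => by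
      simp only [Function.comp, Real.toNNReal_coe]))
  have hW' : ∀ᵐ z ∂fieldMeasure (F.P K) 0 (Matrix.specialUnitaryGroup (Fin 2) ℂ), z ∈ W → (c.jac (V₀, z) : ℝ≥0∞) = G' (V₀, z) :=
    hpt.mono fun z hz hzW => hz (hWL hzW)
  exact eq_of_ae_eq_on_open_of_continuousAt hWo hUW hW' hcU hGz

end Window

end Summit.QuantumFields.YangMills.Theorems.FluctuationComparisonRegPrIntLS2BetaChartJacPinningPoint

end
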